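import Mathlib
import Summits.Ventures.PercRepro.TriangleCapZoneTools

/-!
# PercRepro — ONE BELOW THE THRESHOLD: THE ABSTRACT RESIDUE VALUE OFF THE WINDOW `r < I ≤ D − r`, ANY `D ≥ 2 r`
(p3, gen 56; part 329)

The two regime-free halves of `residue_one_below` (part 325): for `2 ≤ r = t mod D`, `2 r ≤ D`, `I ≤ t`,
`2 r (D − r) ≤ 2 I + φ_D(t + I) + φ_D(t − I) + 2 (r − 1)(r − 2)` holds for `I < r` (`residue_one_below_lt`:
`I (I − 1) ≤ (r − 1)(r − 2)`) and for `I ≥ D − r + 1` (`residue_one_below_wrap`: for `I ≤ D + r − 1` the two residues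
are `p = I − D + r` and `q = D + r − I` with `p + q = 2 r`, the value is `2 I + 2 r (D − 2 r) + 2 p q` and
`D + p + p q ≥ 4 r − 2`; for `I ≥ D + r` subadditivity and `2 I ≥ 2 D + 2 r ≥ 6 r − 4`).  Only the window
`r < I ≤ D − r` needs the structure of the band (parts 330–331).  Axioms: standard.
-/

namespace PercRepro

namespace TriangleCap

namespace C047

open Finset

/-- **`I < r`:** `2 r (D − r) ≤ 2 I + φ_D(t + I) + φ_D(t − I) + 2 (r − 1)(r − 2)` for `2 ≤ r = t mod D ≤ D / 2`. -/
theorem residue_one_below_lt (D t I : ℕ) (hI : I ≤ t) (hr : 2 ≤ t % D) (h2 : 2 * (t % D) ≤ D)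
    (hIr : I < t % D) :
    2 * ((t % D) * (D - t % D)) ≤
      2 * I + phiD D (t + I) + phiD D (t - I) + 2 * ((t % D - 1) * (t % D - 2)) := by
  obtain ⟨r, hr'⟩ : ∃ r, t % D = r := ⟨_, rfl⟩
  rw [hr'] at hr h2 hIr ⊢
  have hrD : r < D := by omega
  rcases Nat.eq_zero_or_pos I with rfl | hI1
  · simp only [add_zero, Nat.sub_zero, mul_zero, zero_add]
    rw [phiD_mod D t, hr', phiD_of_lt D r hrD]
    omega
  have h1 : phiD D (t + I) = (r + I) * (D - r - I) := by
    rw [phiD_mod, Nat.add_mod, hr', Nat.mod_eq_of_lt (show I < D by omega),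
      Nat.mod_eq_of_lt (show r + I < D by omega), phiD_of_lt D _ (by omega), Nat.sub_sub]
  have h2' : phiD D (t - I) = (r - I) * (D - r + I) := by
    have ht : t - I = D * (t / D) + (r - I) := by
      have := Nat.div_add_mod t D
      omega
    rw [phiD_mod, ht, Nat.mul_add_mod, Nat.mod_eq_of_lt (by omega : r - I < D), phiD_of_lt D _ (by omega)]
    congr 1
    omega
  rw [h1, h2']
  have hpr : I * (I - 1) ≤ (r - 1) * (r - 2) := Nat.mul_le_mul (by omega) (by omega)
  zify [hIr.le, (by omega : r ≤ D), (by omega : r + I ≤ D), (by omega : 1 ≤ r), (by omega : 2 ≤ r),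
    (by omega : 1 ≤ I), (by omega : I ≤ D - r)] at hpr ⊢
  nlinarith [hpr]

/-- The wrap case's arithmetic: `p + q = 2 r`, `p, q ≥ 1` ⇒ `2 r (D − r) ≤ 2 (D − r + p) + p (D − p) + q (D − q) +
2 (r − 1)(r − 2)` with `D = p + q + u`, `r = r' + 2`. -/
theorem wrap_arith (p q u r' : ℕ) (hp : 1 ≤ p) (hq1 : 1 ≤ q) (hpq : p + q = 2 * (r' + 2)) :
    2 * ((r' + 2) * (r' + 2 + u)) ≤ 2 * (r' + 2 + u + p) + p * (q + u) + q * (p + u) + 2 * ((r' + 1) * r') := by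
  have hk : 0 ≤ ((p : ℤ) - 1) * ((q : ℤ) - 1) := by
    apply mul_nonneg <;> omega
  zify at hpq ⊢
  nlinarith [hk, hpq]

/-- **`I ≥ D − r + 1`:** `2 r (D − r) ≤ 2 I + φ_D(t + I) + φ_D(t − I) + 2 (r − 1)(r − 2)` for `2 ≤ r = t mod D ≤ D / 2`. -/
theorem residue_one_below_wrap (D t I : ℕ) (hI : I ≤ t) (hr : 2 ≤ t % D) (h2 : 2 * (t % D) ≤ D)
    (hIw : D - t % D + 1 ≤ I) :
    2 * ((t % D) * (D - t % D)) ≤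
      2 * I + phiD D (t + I) + phiD D (t - I) + 2 * ((t % D - 1) * (t % D - 2)) := by
  obtain ⟨r, hr'⟩ : ∃ r, t % D = r := ⟨_, rfl⟩
  rw [hr'] at hr h2 hIw ⊢
  have hrD : r < D := by omega
  have hphi2r := phiD_two_mul_of_le D r h2
  rcases Nat.lt_or_ge I (D + r) with hlt | hge
  · -- `D − r + 1 ≤ I ≤ D + r − 1`: the residues `p = I − D + r`, `q = D + r − I`
    obtain ⟨p, hp⟩ : ∃ p, I = D - r + p := ⟨I - (D - r), by omega⟩
    have hp1 : 1 ≤ p := by omega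
    have hp2 : p + 1 ≤ 2 * r := by omega
    obtain ⟨q, hq⟩ : ∃ q, 2 * r = p + q := ⟨2 * r - p, by omega⟩
    have hq1 : 1 ≤ q := by omega
    have hA : phiD D (t + I) = p * (D - p) := by
      have e : t + I = D * (t / D) + (D + p) := by
        have := Nat.div_add_mod t D
        omega
      rw [phiD_mod, e, Nat.mul_add_mod, show D + p = p + 1 * D by ring, Nat.add_mul_mod_self_right,
        Nat.mod_eq_of_lt (by omega), phiD_of_lt D p (by omega)]
    have hB : phiD D (t - I) = q * (D - q) := by
      have hq1' : 1 ≤ t / D := by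
        by_contra hcon
        have h0 : t / D = 0 := Nat.lt_one_iff.mp (Nat.lt_of_not_le hcon)
        have := Nat.div_add_mod t D
        rw [h0, mul_zero, zero_add, hr'] at this
        omega
      obtain ⟨Q, hQ⟩ : ∃ Q, t / D = Q + 1 := ⟨t / D - 1, by omega⟩
      have e : t - I = D * Q + q := by
        have := Nat.div_add_mod t D
        rw [hQ, Nat.mul_succ, hr'] at this
        omega
      rw [phiD_mod, e, Nat.mul_add_mod, Nat.mod_eq_of_lt (by omega : q < D), phiD_of_lt D q (by omega)]
    rw [hA, hB, hp]
    -- `2 r (D − r) ≤ 2 (D − r + p) + p (D − p) + q (D − q) + 2 (r − 1)(r − 2)` with `p + q = 2 r`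
    obtain ⟨u, hu⟩ : ∃ u, D = p + q + u := ⟨D - (p + q), by omega⟩
    subst hu
    obtain ⟨r', hr2⟩ : ∃ r', r = r' + 2 := ⟨r - 2, by omega⟩
    subst hr2
    have e1 : p + q + u - (r' + 2) = r' + 2 + u := by omega
    have e2 : p + q + u - p = q + u := by omega
    have e3 : p + q + u - q = p + u := by omega
    have e4 : r' + 2 - 1 = r' + 1 := by omega
    have e5 : r' + 2 - 2 = r' := by omega
    rw [e1, e2, e3, e4, e5]
    exact wrap_arith p q u r' hp1 hq1 hq.symm
  · -- `I ≥ D + r`: subadditivity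
    have hsub : phiD D (2 * t) ≤ phiD D (t + I) + phiD D (t - I) := by
      have := phiD_add_le D (t + I) (t - I)
      have e : t + I + (t - I) = 2 * t := by omega
      rw [e] at this
      exact this
    rw [phiD_two_mul_mod, hr', hphi2r] at hsub
    have key : 2 * (r * (D - r)) ≤ 2 * (D + r) + 2 * r * (D - 2 * r) + 2 * ((r - 1) * (r - 2)) := by
      obtain ⟨u, rfl⟩ : ∃ u, D = 2 * r + u := ⟨D - 2 * r, by omega⟩
      obtain ⟨r', rfl⟩ : ∃ r', r = r' + 2 := ⟨r - 2, by omega⟩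
      have e1 : 2 * (r' + 2) + u - (r' + 2) = r' + 2 + u := by omega
      have e2 : 2 * (r' + 2) + u - 2 * (r' + 2) = u := by omega
      have e3 : r' + 2 - 1 = r' + 1 := by omega
      have e4 : r' + 2 - 2 = r' := by omega
      rw [e1, e2, e3, e4]
      nlinarith
    omega

end C047

end TriangleCap

end PercRepro
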